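import Literature.Analysis.FluidPDE.GKPRegularityPersistence
import Literature.Analysis.FluidPDE.NSCriticalClosureBesovProofs
import Literature.Analysis.FluidPDE.LittlewoodPaleyBilinear
import Literature.Analysis.FluidPDE.TaoLocalisationHolds
import Literature.Analysis.FluidPDE.TaoLocalisationProofs
import HarnessLib

/-!
# Classical Leray–Hopf solutions from rapidly decaying data lie in GKP's path space

Analysis/FluidPDE proof file (theorems only: no definition, no named fact, no statement of the
tree is changed), on the discharge path of the named fact
`Literature.Analysis.FluidPDE.hasSmoothExtensionPast_of_eHomBesovNorm_bounded`
(`NSCriticalClosure.lean`; Gallagher–Koch–Planchon 2016, Thm. 1, contrapositive for classical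
Leray–Hopf solutions from rapidly decaying data).

## Why

The GKP seats' audits (`GKPRegularityPersistence.lean`, `GKPCriticalElementsPathSpace.lean`,
`GKPCompactnessPathSpace.lean`, `GKPRigidityProofs.lean`) show that GKP's (1.9), Props. 2.1–2.3
and Thm. 1 are printed for `NS(u₀)`, the solution in Gallagher–Koch–Planchon's path space
`𝓛^{1:∞}_{p,q}[T' < T]` (GKP 2016, Def. 1.2, (1.5), (1.6)), rendered in the tree as
`MemGKPPathSpace p q T U := ∀ T' ∈ (0, T), ‖U‖_{𝓛^{1:∞}_{p,q}(0,T')} < ∞`, and that the tree's wider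
class `IsBesovMildSolutionOn` reduces to it only through an unprinted identification. The
assemblies of the continuation criterion (`NSCriticalClosureBesovExponent.lean`,
`…SingleLeaf.lean`) feed the *classical* solution `(u, U)` into the blow-up criterion; for the
faithful, path-space forms of GKP's statements they must also know that this `(u, U)` lies in
`𝓛^{1:∞}_{p,q}[T' < T]`. This file proves exactly that:

* `memGKPPathSpace_of_classical` — for `ν > 0`, a classical solution of the unforced system on
  `ℝ³ × [0, T)`, Leray–Hopf from its rapidly decaying datum, with slice distributions `U t`, has
  `MemGKPPathSpace p q T U` for every `2 ≤ p < ∞`, `1 ≤ q`.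

Mechanism (GKP 2016, Def. 1.2 and Rem. 1.3; Bahouri–Chemin–Danchin 2011, Lemma 2.1): on a closed
slab `[0, T']`, `T' < T`, Tao 2013 (Cor. 11.1 + Cor. 4.3 + Thm. 5.4 (iv),
`tao2011_hasBoundedSobolevNormsOn_holds`) bounds every `‖Dⁿ u(t)‖_{L²}` uniformly in `t`; hence,
block by block and uniformly in `t ∈ (0, T')`,
`‖Δ̇_j U(t)‖_{L^p} ≤ C 2^{3j(1/2-1/p)} ‖Δ̇_j U(t)‖_{L²}` (Bernstein, `exists_eLpNormDistrib_lpBlock_le`)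
with `‖Δ̇_j U(t)‖_{L²} ≤ C ‖u(t)‖_{L²}` (`exists_eLpNormDistrib_lpBlock_le_eLpNormDistrib`) and
`‖Δ̇_j U(t)‖_{L²} ≤ C 2^{-3j} ∑ ‖∂³U(t)‖_{L²}` (`exists_eLpNormDistrib_lpBlock_le_sum_lineDeriv`
three times, the distributional derivatives being the classical ones,
`IsDistributionOf.iteratedFDeriv_cons`); since `s_p + 3(1/2 - 1/p) = 1/2`, the weights of
`L̃^∞((0,T'); Ḃ^{s_p}_{p,q})` are `≤ K 2^{-|j|/2}` and those of `L̃¹((0,T'); Ḃ^{s_p+2}_{p,q})` are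
`≤ K T' 2^{-|j|/2}`, both summable (`tsum_two_rpow_neg_abs_half_ne_top`), for every `q ≥ 1`
(`eLpNorm_count_exponent_antitone`).

Also proved, reusable: `IsDistributionOf.iteratedFDeriv_cons` (distributions of iterated
classical derivatives), `exists_eLpNormDistrib_lpBlock_two_le_of_third_derivatives` (the `2^{-3j}`
block bound from third distributional derivatives), `eLpNorm_count_lt_top_of_le_two_rpow_neg_abs`,
`eCheminLernerNorm_lt_top_of_blockwise` (a blockwise, time-uniform bound `≤ M 2^{-|j|/2} 2^{-js}`
gives `L̃^ρ(S; Ḃ^s_{p,q})` finiteness on a time set of finite measure).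

## Mathlib / tree search

Tree: `MemGKPPathSpace` (`GKPRegularityPersistence`), `eCheminLernerNorm`, `eBlockTimeNorm`,
`eGKPPathNorm_one_top`, `criticalIndex` (`FunctionSpaces/CheminLerner`),
`exists_eLpNormDistrib_lpBlock_le` (`LittlewoodPaleyBernsteinProofs`),
`exists_eLpNormDistrib_lpBlock_le_eLpNormDistrib`, `exists_eLpNormDistrib_lpBlock_le_sum_lineDeriv`,
`IsDistributionOf.lineDeriv` (`NSCriticalClosureBesovProofs`), `IsDistributionOf.eLpNormDistrib_eq`
(`LittlewoodPaleyBlockFn`), `tsum_two_rpow_neg_abs_half_ne_top` (`LittlewoodPaleyBilinear`),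
`eLpNorm_count_exponent_antitone` (`GKPCriticalElements`),
`tao2011_hasBoundedSobolevNormsOn.closedSlab`, `tao2011_hasBoundedSobolevNormsOn_holds`,
`linfty_bound_of_hasBoundedSobolevNormsOn_holds` (`TaoLocalisation*`). No statement placing
classical solutions in `𝓛^{1:∞}` existed (`lean search 'MemGKPPathSpace'`). Mathlib:
`DifferentiableAt.iteratedFDeriv_succ_apply_left'`, `ContDiff.iteratedFDeriv_right`,
`ContinuousMultilinearMap.le_opNorm`, `eLpNorm_le_of_ae_enorm_bound`, `lintegral_count`.

## References

* I. Gallagher, G. S. Koch, F. Planchon, *Blow-up of critical Besov norms at a potential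
  Navier–Stokes singularity*, Comm. Math. Phys. 343 (2016) 39–82 = arXiv:1407.4156, Def. 1.2,
  (1.5), (1.6), Rem. 1.3. [GKP2016]
* H. Bahouri, J.-Y. Chemin, R. Danchin, *Fourier Analysis and Nonlinear Partial Differential
  Equations* (2011), Lemma 2.1, Def. 2.67. [BahouriCheminDanchin2011]
* T. Tao, *Localisation and compactness properties of the Navier–Stokes global regularity
  problem*, Anal. PDE 6 (2013) 25–107, Cor. 11.1, Cor. 4.3, Thm. 5.4. [Tao2011]
-/

noncomputable section

open MeasureTheory TemperedDistribution Set Function Filter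
open _root_.Topology
open scoped SchwartzMap ENNReal NNReal LineDeriv

namespace Literature.Analysis.FluidPDE

/-! ### Distributions of iterated classical derivatives -/

section IteratedDerivatives

variable {ι : Type*} [Fintype ι] {E : Type*} [NormedAddCommGroup E] [InnerProductSpace ℝ E]
  [FiniteDimensional ℝ E] [MeasurableSpace E] [BorelSpace E]

/-- **Distributions of iterated classical derivatives.** If `W` is the distribution of the
slice `x ↦ Dᵏf(x)(v)` of the `k`-th derivative of a `C^{k+1}` field `f` along fixed directions
`v`, and `Dᵏf, Dᵏ⁺¹f ∈ L²`, then `∂_m W` is the distribution of `x ↦ Dᵏ⁺¹f(x)(m, v)`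
(`IsDistributionOf.lineDeriv` applied to `x ↦ Dᵏf(x)(v)`, whose derivative along `m` is
`Dᵏ⁺¹f(x)(m, v)`, Mathlib's `DifferentiableAt.iteratedFDeriv_succ_apply_left'`). [folklore] -/
theorem IsDistributionOf.iteratedFDeriv_cons {n : ℕ∞} {k : ℕ} {f : E → EuclideanSpace ℝ ι}
    {v : Fin k → E} {W : 𝓢'(E, EuclideanSpace ℂ ι)}
    (hW : IsDistributionOf (fun x => iteratedFDeriv ℝ k f x v) W) (hf : ContDiff ℝ n f)
    (hkn : (k : ℕ∞) + 1 ≤ n) (hk2 : MemLp (iteratedFDeriv ℝ k f) 2 volume)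
    (hk2' : MemLp (iteratedFDeriv ℝ (k + 1) f) 2 volume) (m : E) :
    IsDistributionOf (fun x => iteratedFDeriv ℝ (k + 1) f x (Fin.cons m v)) (∂_{m} W) := by
  set g : E → EuclideanSpace ℝ ι := fun x => iteratedFDeriv ℝ k f x v with hg
  have hdiff : ContDiff ℝ 1 (iteratedFDeriv ℝ k f) := by
    refine hf.iteratedFDeriv_right ?_
    calc ((1 : ℕ∞) : WithTop ℕ∞) + k = ((k : ℕ∞) + 1 : ℕ∞) := by push_cast; ring
      _ ≤ n := by exact_mod_cast hkn
  have hg1 : ContDiff ℝ 1 g :=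
    (ContinuousMultilinearMap.apply ℝ (fun _ : Fin k => E) (EuclideanSpace ℝ ι) v).contDiff.comp
      hdiff
  have hprod : ∀ (l : ℕ) (w : Fin l → E) (x : E),
      ‖iteratedFDeriv ℝ l f x w‖ ≤ (∏ i, ‖w i‖) * ‖iteratedFDeriv ℝ l f x‖ := fun l w x => by
    rw [mul_comm]
    exact (iteratedFDeriv ℝ l f x).le_opNorm w
  have hg2 : MemLp g 2 volume :=
    MemLp.of_le_mul hk2 hg1.continuous.aestronglyMeasurable
      (Eventually.of_forall fun x => hprod k v x)
  -- the derivative of `g` along `m`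
  have hderiv : ∀ x, fderiv ℝ g x m = iteratedFDeriv ℝ (k + 1) f x (Fin.cons m v) := by
    intro x
    have hd : DifferentiableAt ℝ (iteratedFDeriv ℝ k f) x := hdiff.differentiable one_ne_zero x
    rw [hd.iteratedFDeriv_succ_apply_left']
    simp only [Fin.tail_cons, Fin.cons_zero, hg]
  have hcont' : Continuous fun x => iteratedFDeriv ℝ (k + 1) f x (Fin.cons m v) :=
    (ContinuousMultilinearMap.apply ℝ (fun _ : Fin (k + 1) => E) (EuclideanSpace ℝ ι)
      (Fin.cons m v)).continuous.comp (hf.continuous_iteratedFDeriv (by exact_mod_cast hkn))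
  have hgm : MemLp (fun x => fderiv ℝ g x m) 2 volume := by
    rw [show (fun x => fderiv ℝ g x m) = fun x => iteratedFDeriv ℝ (k + 1) f x (Fin.cons m v) from
      funext hderiv]
    exact MemLp.of_le_mul hk2' hcont'.aestronglyMeasurable
      (Eventually.of_forall fun x => hprod (k + 1) (Fin.cons m v) x)
  have key := hW.lineDeriv hg1 hg2 m hgm
  rwa [show (fun x => fderiv ℝ g x m) = fun x => iteratedFDeriv ℝ (k + 1) f x (Fin.cons m v) from
    funext hderiv] at key

/-- The base case: `W` is the distribution of `x ↦ D⁰f(x)() = f(x)`. [folklore] -/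
theorem IsDistributionOf.iteratedFDeriv_zero {f : E → EuclideanSpace ℝ ι}
    {W : 𝓢'(E, EuclideanSpace ℂ ι)} (hW : IsDistributionOf f W) :
    IsDistributionOf (fun x => iteratedFDeriv ℝ 0 f x Fin.elim0) W := by
  simpa only [iteratedFDeriv_zero_apply] using hW

/-- **`L²` norms of third distributional derivatives of a smooth `H³` field.** If `W` is the
distribution of a `C³` field `f` with `f, Df, D²f, D³f ∈ L²`, then for all directions
`m₁, m₂, m₃` the distribution `∂_{m₃} ∂_{m₂} ∂_{m₁} W` is the distribution of
`x ↦ D³f(x)(m₃, m₂, m₁)` and `‖∂_{m₃} ∂_{m₂} ∂_{m₁} W‖_{L²} ≤ ‖m₁‖ ‖m₂‖ ‖m₃‖ ‖D³f‖_{L²}`.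
[folklore] -/
theorem IsDistributionOf.eLpNormDistrib_lineDeriv_three_le {n : ℕ∞} {f : E → EuclideanSpace ℝ ι}
    {W : 𝓢'(E, EuclideanSpace ℂ ι)} (hW : IsDistributionOf f W) (hf : ContDiff ℝ n f)
    (h3n : 3 ≤ n) (h0 : MemLp f 2 volume) (h1 : MemLp (iteratedFDeriv ℝ 1 f) 2 volume)
    (h2 : MemLp (iteratedFDeriv ℝ 2 f) 2 volume) (h3 : MemLp (iteratedFDeriv ℝ 3 f) 2 volume)
    (m₁ m₂ m₃ : E) :
    FunctionSpaces.eLpNormDistrib 2 (∂_{m₃} (∂_{m₂} (∂_{m₁} W))) ≤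
      ENNReal.ofReal (‖m₁‖ * ‖m₂‖ * ‖m₃‖) * eLpNorm (iteratedFDeriv ℝ 3 f) 2 volume := by
  have h0' : MemLp (iteratedFDeriv ℝ 0 f) 2 volume := by
    refine MemLp.of_le_mul (c := 1) h0 ?_ (Eventually.of_forall fun x => ?_)
    · exact (hf.continuous_iteratedFDeriv (by positivity)).aestronglyMeasurable
    · rw [norm_iteratedFDeriv_zero, one_mul]
  have d1 : IsDistributionOf (fun x => iteratedFDeriv ℝ 1 f x (Fin.cons m₁ Fin.elim0)) (∂_{m₁} W) :=
    hW.iteratedFDeriv_zero.iteratedFDeriv_cons hf (by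
      calc ((0 : ℕ) : ℕ∞) + 1 = 1 := by norm_num
        _ ≤ 3 := by norm_num
        _ ≤ n := h3n) h0' h1 m₁
  have d2 : IsDistributionOf
      (fun x => iteratedFDeriv ℝ 2 f x (Fin.cons m₂ (Fin.cons m₁ Fin.elim0))) (∂_{m₂} (∂_{m₁} W)) :=
    d1.iteratedFDeriv_cons hf (by
      calc ((1 : ℕ) : ℕ∞) + 1 = 2 := by norm_num
        _ ≤ 3 := by norm_num
        _ ≤ n := h3n) h1 h2 m₂
  have d3 : IsDistributionOf
      (fun x => iteratedFDeriv ℝ 3 f x (Fin.cons m₃ (Fin.cons m₂ (Fin.cons m₁ Fin.elim0))))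
      (∂_{m₃} (∂_{m₂} (∂_{m₁} W))) :=
    d2.iteratedFDeriv_cons hf (by
      calc ((2 : ℕ) : ℕ∞) + 1 = 3 := by norm_num
        _ ≤ n := h3n) h2 h3 m₃
  -- the third-derivative slice is in `L²`, with the product bound
  set w : Fin 3 → E := Fin.cons m₃ (Fin.cons m₂ (Fin.cons m₁ Fin.elim0)) with hw
  have hptw : ∀ x, ‖iteratedFDeriv ℝ 3 f x w‖ ≤ (‖m₁‖ * ‖m₂‖ * ‖m₃‖) * ‖iteratedFDeriv ℝ 3 f x‖ := by
    intro x
    have h := (iteratedFDeriv ℝ 3 f x).le_opNorm w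
    have hp : ∏ i, ‖w i‖ = ‖m₁‖ * ‖m₂‖ * ‖m₃‖ := by
      simp only [hw, Fin.prod_univ_three, Fin.cons_zero, Fin.cons_one]
      simp only [show (2 : Fin 3) = Fin.succ (Fin.succ 0) from rfl, Fin.cons_succ, Fin.cons_zero]
      ring
    rw [hp] at h
    linarith [h]
  have hcont : Continuous fun x => iteratedFDeriv ℝ 3 f x w :=
    (ContinuousMultilinearMap.apply ℝ (fun _ : Fin 3 => E) (EuclideanSpace ℝ ι) w).continuous.comp
      (hf.continuous_iteratedFDeriv (by simpa using (WithTop.coe_le_coe.2 h3n :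
        ((3 : ℕ∞) : WithTop ℕ∞) ≤ (n : WithTop ℕ∞))))
  have hmem : MemLp (fun x => iteratedFDeriv ℝ 3 f x w) 2 volume :=
    MemLp.of_le_mul h3 hcont.aestronglyMeasurable (Eventually.of_forall hptw)
  rw [d3.eLpNormDistrib_eq hmem]
  calc eLpNorm (fun x => iteratedFDeriv ℝ 3 f x w) 2 volume
      ≤ ENNReal.ofReal (‖m₁‖ * ‖m₂‖ * ‖m₃‖) * eLpNorm (iteratedFDeriv ℝ 3 f) 2 volume :=
        eLpNorm_le_mul_eLpNorm_of_ae_le_mul (Eventually.of_forall hptw) 2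

end IteratedDerivatives

/-! ### The `2^{-3j}` block bound from third distributional derivatives -/

section BlockBounds

variable {E : Type*} [NormedAddCommGroup E] [InnerProductSpace ℝ E] [FiniteDimensional ℝ E]
  [MeasurableSpace E] [BorelSpace E] {F : Type*} [NormedAddCommGroup F] [NormedSpace ℂ F]
  [CompleteSpace F]

/-- **Blocks of distributions with third derivatives in `L²` decay like `2^{-3j}`**: there is a
constant `K` (depending only on the dimension and an orthonormal basis `b`) such that whenever all
third distributional derivatives `∂_{b l} ∂_{b k} ∂_{b i} W` have `L²` norm `≤ B`, every block
satisfies `‖Δ̇_j W‖_{L²} ≤ K 2^{-3j} B` — Danchin's derivative form of Bernstein's inequality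
`‖Δ̇_j u‖ ≤ C 2^{-j} ∑ᵢ ‖Δ̇_j ∂ᵢ u‖` (`exists_eLpNormDistrib_lpBlock_le_sum_lineDeriv`) three times
and the uniform `L²` bound of the blocks (`exists_eLpNormDistrib_lpBlock_le_eLpNormDistrib`).
[cite: BahouriCheminDanchin2011, Lemma 2.1] -/
theorem exists_eLpNormDistrib_lpBlock_two_le_of_third_derivatives {ι : Type*} [Fintype ι]
    (b : OrthonormalBasis ι ℝ E) :
    ∃ K : ℝ≥0, ∀ (W : 𝓢'(E, F)) (B : ℝ≥0∞),
      (∀ i k l, FunctionSpaces.eLpNormDistrib 2 (∂_{b l} (∂_{b k} (∂_{b i} W))) ≤ B) →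
      ∀ j : ℤ, FunctionSpaces.eLpNormDistrib 2 (FunctionSpaces.lpBlock j W) ≤
        K * (2 : ℝ≥0∞) ^ (-(3 * (j : ℝ))) * B := by
  classical
  obtain ⟨CA, hCA⟩ := exists_eLpNormDistrib_lpBlock_le_eLpNormDistrib (E := E) (F := F) 2
  obtain ⟨CD, hCD⟩ := exists_eLpNormDistrib_lpBlock_le_sum_lineDeriv (E := E) (F := F) 2 b
  set N : ℝ≥0 := (Fintype.card ι : ℝ≥0) with hN
  refine ⟨CD * N * (CD * N * (CD * N * CA)), fun W B hB j => ?_⟩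
  set D : 𝓢'(E, F) → ℝ≥0∞ := fun V => FunctionSpaces.eLpNormDistrib 2 (FunctionSpaces.lpBlock j V)
    with hD
  set r : ℝ≥0∞ := (2 : ℝ≥0∞) ^ (-(j : ℝ)) with hr
  -- innermost level: `D (∂∂∂ W) ≤ CA * B`
  have h3 : ∀ i k l, D (∂_{b l} (∂_{b k} (∂_{b i} W))) ≤ CA * B := fun i k l =>
    (hCA j _).trans (by gcongr; exact hB i k l)
  -- second level
  have h2 : ∀ i k, D (∂_{b k} (∂_{b i} W)) ≤ CD * r * (N * (CA * B)) := by
    intro i k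
    refine (hCD j _).trans ?_
    gcongr
    calc ∑ l, D (∂_{b l} (∂_{b k} (∂_{b i} W))) ≤ ∑ _l : ι, CA * B :=
          Finset.sum_le_sum fun l _ => h3 i k l
      _ = N * (CA * B) := by
          rw [Finset.sum_const, Finset.card_univ, hN, nsmul_eq_mul]; push_cast; ring
  -- first level
  have h1 : ∀ i, D (∂_{b i} W) ≤ CD * r * (N * (CD * r * (N * (CA * B)))) := by
    intro i
    refine (hCD j _).trans ?_
    gcongr
    calc ∑ k, D (∂_{b k} (∂_{b i} W)) ≤ ∑ _k : ι, CD * r * (N * (CA * B)) :=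
          Finset.sum_le_sum fun k _ => h2 i k
      _ = N * (CD * r * (N * (CA * B))) := by
          rw [Finset.sum_const, Finset.card_univ, hN, nsmul_eq_mul]; push_cast; ring
  -- level zero
  have h0 : D W ≤ CD * r * (N * (CD * r * (N * (CD * r * (N * (CA * B)))))) := by
    refine (hCD j _).trans ?_
    gcongr
    calc ∑ i, D (∂_{b i} W) ≤ ∑ _i : ι, CD * r * (N * (CD * r * (N * (CA * B)))) :=
          Finset.sum_le_sum fun i _ => h1 i
      _ = N * (CD * r * (N * (CD * r * (N * (CA * B))))) := by
          rw [Finset.sum_const, Finset.card_univ, hN, nsmul_eq_mul]; push_cast; ring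
  have hr3 : r * r * r = (2 : ℝ≥0∞) ^ (-(3 * (j : ℝ))) := by
    rw [hr, FunctionSpaces.two_rpow_mul_two_rpow, FunctionSpaces.two_rpow_mul_two_rpow]
    ring_nf
  calc D W ≤ CD * r * (N * (CD * r * (N * (CD * r * (N * (CA * B)))))) := h0
    _ = (CD * N * (CD * N * (CD * N * CA)) : ℝ≥0∞) * (r * r * r) * B := by ring
    _ = ((CD * N * (CD * N * (CD * N * CA)) : ℝ≥0) : ℝ≥0∞) * (2 : ℝ≥0∞) ^ (-(3 * (j : ℝ))) * B := by
        rw [hr3]; push_cast; ring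

end BlockBounds

/-! ### Summation: blockwise bounds give finite Chemin–Lerner norms -/

section Summation

variable {E : Type*} [NormedAddCommGroup E] [InnerProductSpace ℝ E] [FiniteDimensional ℝ E]
  [MeasurableSpace E] [BorelSpace E] {F : Type*} [NormedAddCommGroup F] [NormedSpace ℂ F]
  [CompleteSpace F]

/-- **`ℓ^q` sums of two-sided geometric sequences are finite**: if `a_j ≤ M 2^{-|j|/2}` with
`M < ∞` then `‖a‖_{ℓ^q(ℤ)} < ∞` for every `q ≥ 1` (`ℓ¹ ⊂ ℓ^q` and `∑ 2^{-|j|/2} < ∞`).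
[folklore] -/
theorem eLpNorm_count_lt_top_of_le_two_rpow_neg_abs {a : ℤ → ℝ≥0∞} {M : ℝ≥0∞} (hM : M ≠ ⊤)
    (ha : ∀ j : ℤ, a j ≤ M * (2 : ℝ≥0∞) ^ (-(|(j : ℝ)| / 2))) {q : ℝ≥0∞} (hq : 1 ≤ q) :
    eLpNorm a q Measure.count < ⊤ := by
  have h1 : eLpNorm a 1 Measure.count = ∑' j, a j := by
    rw [eLpNorm_one_eq_lintegral_enorm, lintegral_count]
    simp only [enorm_eq_self]
  calc eLpNorm a q Measure.count ≤ eLpNorm a 1 Measure.count :=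
        eLpNorm_count_exponent_antitone a one_ne_zero hq
    _ = ∑' j, a j := h1
    _ ≤ ∑' j : ℤ, M * (2 : ℝ≥0∞) ^ (-(|(j : ℝ)| / 2)) := ENNReal.tsum_le_tsum ha
    _ = M * ∑' j : ℤ, (2 : ℝ≥0∞) ^ (-(|(j : ℝ)| / 2)) := ENNReal.tsum_mul_left
    _ < ⊤ := ENNReal.mul_lt_top hM.lt_top (lt_top_iff_ne_top.2 tsum_two_rpow_neg_abs_half_ne_top)

/-- **Blockwise, time-uniform bounds give finite Chemin–Lerner norms** (GKP 2016, Def. 1.2: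
`‖U‖_{L̃^ρ(S; Ḃ^s_{p,q})} = ‖(2^{js} ‖‖Δ̇_j U(t)‖_{L^p}‖_{L^ρ_t(S)})_j‖_{ℓ^q}`). If on a time set
`S` of finite measure the blocks of the path `U` satisfy, uniformly in `t ∈ S`,
`2^{js} ‖Δ̇_j U(t)‖_{L^p} ≤ M 2^{-|j|/2}` with `M < ∞`, then `‖U‖_{L̃^ρ(S; Ḃ^s_{p,q})} < ∞` for all
`ρ` and all `q ≥ 1`: the time norm of the `j`-th block is at most `(μ S)^{1/ρ}` times its
uniform bound (`eLpNorm_le_of_ae_enorm_bound`), and the weights are then summable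
(`eLpNorm_count_lt_top_of_le_two_rpow_neg_abs`). [cite: GKP2016, Def. 1.2] -/
theorem eCheminLernerNorm_lt_top_of_blockwise {ρ : ℝ≥0∞} {S : Set ℝ} (hS : MeasurableSet S)
    (hSfin : volume S ≠ ⊤) {s : ℝ} {p q : ℝ≥0∞} [Fact (1 ≤ p)] (hq : 1 ≤ q) {U : ℝ → 𝓢'(E, F)}
    {M : ℝ≥0∞} (hM : M ≠ ⊤)
    (hb : ∀ t ∈ S, ∀ j : ℤ, (2 : ℝ≥0∞) ^ ((j : ℝ) * s) *
      FunctionSpaces.eLpNormDistrib p (FunctionSpaces.lpBlock j (U t)) ≤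
        M * (2 : ℝ≥0∞) ^ (-(|(j : ℝ)| / 2))) :
    FunctionSpaces.eCheminLernerNorm ρ S s p q U < ⊤ := by
  rw [FunctionSpaces.eCheminLernerNorm_def]
  set V : ℝ≥0∞ := (volume S) ^ ρ.toReal⁻¹ with hV
  have hVtop : V ≠ ⊤ := ENNReal.rpow_ne_top_of_nonneg (inv_nonneg.2 ENNReal.toReal_nonneg) hSfin
  -- the time norm of each block
  have hblock : ∀ j : ℤ, (2 : ℝ≥0∞) ^ ((j : ℝ) * s) * FunctionSpaces.eBlockTimeNorm ρ S p U j ≤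
      (M * V) * (2 : ℝ≥0∞) ^ (-(|(j : ℝ)| / 2)) := by
    intro j
    have hpos : (2 : ℝ≥0∞) ^ ((j : ℝ) * s) ≠ 0 :=
      (ENNReal.rpow_pos (by norm_num) ENNReal.ofNat_ne_top).ne'
    have htop : (2 : ℝ≥0∞) ^ ((j : ℝ) * s) ≠ ⊤ := ENNReal.rpow_ne_top_of_ne_zero two_ne_zero ENNReal.ofNat_ne_top
    -- pointwise bound on the integrand, a.e. on `S`
    set c : ℝ≥0∞ := ((2 : ℝ≥0∞) ^ ((j : ℝ) * s))⁻¹ * (M * (2 : ℝ≥0∞) ^ (-(|(j : ℝ)| / 2))) with hc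
    have hae : ∀ᵐ t ∂(volume.restrict S),
        ‖FunctionSpaces.eLpNormDistrib p (FunctionSpaces.lpBlock j (U t))‖ₑ ≤ c := by
      filter_upwards [ae_restrict_mem hS] with t ht
      rw [enorm_eq_self, hc]
      have h := hb t ht j
      calc FunctionSpaces.eLpNormDistrib p (FunctionSpaces.lpBlock j (U t))
          = ((2 : ℝ≥0∞) ^ ((j : ℝ) * s))⁻¹ * ((2 : ℝ≥0∞) ^ ((j : ℝ) * s) *
              FunctionSpaces.eLpNormDistrib p (FunctionSpaces.lpBlock j (U t))) := by
            rw [← mul_assoc, ENNReal.inv_mul_cancel hpos htop, one_mul]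
        _ ≤ ((2 : ℝ≥0∞) ^ ((j : ℝ) * s))⁻¹ * (M * (2 : ℝ≥0∞) ^ (-(|(j : ℝ)| / 2))) := by gcongr
    have h1 : FunctionSpaces.eBlockTimeNorm ρ S p U j ≤ c * V := by
      rw [FunctionSpaces.eBlockTimeNorm_def]
      refine (eLpNorm_le_of_ae_enorm_bound hae).trans_eq ?_
      rw [hV, Measure.restrict_apply_univ, smul_eq_mul]
    calc (2 : ℝ≥0∞) ^ ((j : ℝ) * s) * FunctionSpaces.eBlockTimeNorm ρ S p U j
        ≤ (2 : ℝ≥0∞) ^ ((j : ℝ) * s) * (c * V) := by gcongr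
      _ = (M * V) * (2 : ℝ≥0∞) ^ (-(|(j : ℝ)| / 2)) := by
          rw [hc, ← mul_assoc, ← mul_assoc, ENNReal.mul_inv_cancel hpos htop, one_mul]; ring
  exact eLpNorm_count_lt_top_of_le_two_rpow_neg_abs (ENNReal.mul_ne_top hM hVtop) hblock hq

end Summation

/-! ### The dyadic exponents -/

section Exponents

/-- Low frequencies, `L̃^∞ Ḃ^{s_p}` weight: for `j ≤ 0` and `sp + σ = 1/2`,
`2^{j sp} 2^{j σ} = 2^{-|j|/2}`. [folklore] -/
theorem two_rpow_weight_low {sp σ : ℝ} (h : sp + σ = 1 / 2) {j : ℤ} (hj : j ≤ 0) :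
    (2 : ℝ≥0∞) ^ ((j : ℝ) * sp) * (2 : ℝ≥0∞) ^ ((j : ℝ) * σ) = (2 : ℝ≥0∞) ^ (-(|(j : ℝ)| / 2)) := by
  rw [FunctionSpaces.two_rpow_mul_two_rpow, abs_of_nonpos (by exact_mod_cast hj)]
  congr 1
  calc (j : ℝ) * sp + (j : ℝ) * σ = (j : ℝ) * (sp + σ) := by ring
    _ = -(-(j : ℝ) / 2) := by rw [h]; ring

/-- High frequencies, `L̃^∞ Ḃ^{s_p}` weight: for `0 ≤ j` and `sp + σ = 1/2`,
`2^{j sp} 2^{j σ} 2^{-3j} ≤ 2^{-|j|/2}`. [folklore] -/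
theorem two_rpow_weight_high {sp σ : ℝ} (h : sp + σ = 1 / 2) {j : ℤ} (hj : 0 ≤ j) :
    (2 : ℝ≥0∞) ^ ((j : ℝ) * sp) * ((2 : ℝ≥0∞) ^ ((j : ℝ) * σ) * (2 : ℝ≥0∞) ^ (-(3 * (j : ℝ)))) ≤
      (2 : ℝ≥0∞) ^ (-(|(j : ℝ)| / 2)) := by
  rw [FunctionSpaces.two_rpow_mul_two_rpow, FunctionSpaces.two_rpow_mul_two_rpow, abs_of_nonneg (by exact_mod_cast hj)]
  refine two_rpow_le_two_rpow ?_
  have hj' : (0 : ℝ) ≤ j := by exact_mod_cast hj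
  calc (j : ℝ) * sp + ((j : ℝ) * σ + -(3 * (j : ℝ))) = (j : ℝ) * (sp + σ) - 3 * j := by ring
    _ = (j : ℝ) / 2 - 3 * j := by rw [h]; ring
    _ ≤ -((j : ℝ) / 2) := by linarith

/-- Low frequencies, `L̃¹ Ḃ^{s_p+2}` weight: for `j ≤ 0` and `sp + σ = 1/2`,
`2^{j (sp+2)} 2^{j σ} ≤ 2^{-|j|/2}`. [folklore] -/
theorem two_rpow_weight_low_two {sp σ : ℝ} (h : sp + σ = 1 / 2) {j : ℤ} (hj : j ≤ 0) :
    (2 : ℝ≥0∞) ^ ((j : ℝ) * (sp + 2)) * (2 : ℝ≥0∞) ^ ((j : ℝ) * σ) ≤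
      (2 : ℝ≥0∞) ^ (-(|(j : ℝ)| / 2)) := by
  rw [FunctionSpaces.two_rpow_mul_two_rpow, abs_of_nonpos (by exact_mod_cast hj)]
  refine two_rpow_le_two_rpow ?_
  have hj' : (j : ℝ) ≤ 0 := by exact_mod_cast hj
  calc (j : ℝ) * (sp + 2) + (j : ℝ) * σ = (j : ℝ) * (sp + σ) + 2 * j := by ring
    _ = (j : ℝ) / 2 + 2 * j := by rw [h]; ring
    _ ≤ -(-(j : ℝ) / 2) := by linarith

/-- High frequencies, `L̃¹ Ḃ^{s_p+2}` weight: for `0 ≤ j` and `sp + σ = 1/2`,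
`2^{j (sp+2)} 2^{j σ} 2^{-3j} = 2^{-|j|/2}`. [folklore] -/
theorem two_rpow_weight_high_two {sp σ : ℝ} (h : sp + σ = 1 / 2) {j : ℤ} (hj : 0 ≤ j) :
    (2 : ℝ≥0∞) ^ ((j : ℝ) * (sp + 2)) * ((2 : ℝ≥0∞) ^ ((j : ℝ) * σ) * (2 : ℝ≥0∞) ^ (-(3 * (j : ℝ)))) =
      (2 : ℝ≥0∞) ^ (-(|(j : ℝ)| / 2)) := by
  rw [FunctionSpaces.two_rpow_mul_two_rpow, FunctionSpaces.two_rpow_mul_two_rpow, abs_of_nonneg (by exact_mod_cast hj)]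
  congr 1
  calc (j : ℝ) * (sp + 2) + ((j : ℝ) * σ + -(3 * (j : ℝ))) = (j : ℝ) * (sp + σ) - j := by ring
    _ = -((j : ℝ) / 2) := by rw [h]; ring

end Exponents

/-! ### Slices with bounded Sobolev norms: the blockwise bounds -/

section Slices

/-- **The blockwise bounds on a slab.** Let the slices `u t`, `t ∈ S`, be `C³` fields on `ℝ³`
with `∫ ‖u(t)‖² ≤ C₀` and `∫ ‖Dⁿu(t)‖² ≤ Cₙ`, `n = 1, 2, 3`, and let `U t` be their
distributions. Then there is `M < ∞` with, for all `t ∈ S` and `j ∈ ℤ`,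
`‖Δ̇_j U(t)‖_{L^p} ≤ M 2^{3j(1/2-1/p)}` and `‖Δ̇_j U(t)‖_{L^p} ≤ M 2^{3j(1/2-1/p)} 2^{-3j}`
(`2 ≤ p`; Bernstein `L² → L^p` on the blocks, the uniform `L²` bound of the blocks, and the
third-derivative bound `exists_eLpNormDistrib_lpBlock_two_le_of_third_derivatives`).
[cite: BahouriCheminDanchin2011, Lemma 2.1] -/
theorem exists_blockwise_bound_of_sobolev {S : Set ℝ}
    {u : ℝ → EuclideanSpace ℝ (Fin 3) → EuclideanSpace ℝ (Fin 3)}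
    {U : ℝ → 𝓢'(EuclideanSpace ℝ (Fin 3), EuclideanSpace ℂ (Fin 3))}
    (hU : ∀ t ∈ S, IsDistributionOf (u t) (U t)) (hC3 : ∀ t ∈ S, ContDiff ℝ 3 (u t))
    {C₀ C₁ C₂ C₃ : ℝ≥0}
    (h0 : ∀ t ∈ S, ∫⁻ x, ‖u t x‖ₑ ^ 2 ≤ C₀)
    (h1 : ∀ t ∈ S, ∫⁻ x, ‖iteratedFDeriv ℝ 1 (u t) x‖ₑ ^ 2 ≤ C₁)
    (h2 : ∀ t ∈ S, ∫⁻ x, ‖iteratedFDeriv ℝ 2 (u t) x‖ₑ ^ 2 ≤ C₂)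
    (h3 : ∀ t ∈ S, ∫⁻ x, ‖iteratedFDeriv ℝ 3 (u t) x‖ₑ ^ 2 ≤ C₃)
    (p : ℝ≥0∞) [Fact (1 ≤ p)] (hp₂ : 2 ≤ p) :
    ∃ M : ℝ≥0∞, M ≠ ⊤ ∧ ∀ t ∈ S, ∀ j : ℤ,
      FunctionSpaces.eLpNormDistrib p (FunctionSpaces.lpBlock j (U t)) ≤
          M * (2 : ℝ≥0∞) ^ ((j : ℝ) * (3 * (2⁻¹ - p.toReal⁻¹))) ∧
        FunctionSpaces.eLpNormDistrib p (FunctionSpaces.lpBlock j (U t)) ≤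
          M * ((2 : ℝ≥0∞) ^ ((j : ℝ) * (3 * (2⁻¹ - p.toReal⁻¹))) * (2 : ℝ≥0∞) ^ (-(3 * (j : ℝ)))) := by
  obtain ⟨CB, -, hCB⟩ := FunctionSpaces.exists_eLpNormDistrib_lpBlock_le
    (E := EuclideanSpace ℝ (Fin 3)) (F := EuclideanSpace ℂ (Fin 3)) 2 p hp₂
  obtain ⟨CA, hCA⟩ := exists_eLpNormDistrib_lpBlock_le_eLpNormDistrib
    (E := EuclideanSpace ℝ (Fin 3)) (F := EuclideanSpace ℂ (Fin 3)) 2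
  obtain ⟨K, hK⟩ := exists_eLpNormDistrib_lpBlock_two_le_of_third_derivatives
    (E := EuclideanSpace ℝ (Fin 3)) (F := EuclideanSpace ℂ (Fin 3)) (EuclideanSpace.basisFun (Fin 3) ℝ)
  set b : OrthonormalBasis (Fin 3) ℝ (EuclideanSpace ℝ (Fin 3)) := EuclideanSpace.basisFun (Fin 3) ℝ
    with hb
  -- the `L²` sizes
  set A₀ : ℝ≥0∞ := (C₀ : ℝ≥0∞) ^ (1 / 2 : ℝ) with hA₀
  set A₃ : ℝ≥0∞ := (C₃ : ℝ≥0∞) ^ (1 / 2 : ℝ) with hA₃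
  have hA₀top : A₀ ≠ ⊤ := ENNReal.rpow_ne_top_of_nonneg (by norm_num) ENNReal.coe_ne_top
  have hA₃top : A₃ ≠ ⊤ := ENNReal.rpow_ne_top_of_nonneg (by norm_num) ENNReal.coe_ne_top
  set M : ℝ≥0∞ := CB * (CA * A₀) + CB * (K * A₃) with hM
  have hMtop : M ≠ ⊤ :=
    ENNReal.add_ne_top.2 ⟨ENNReal.mul_ne_top ENNReal.coe_ne_top (ENNReal.mul_ne_top ENNReal.coe_ne_top hA₀top),
      ENNReal.mul_ne_top ENNReal.coe_ne_top (ENNReal.mul_ne_top ENNReal.coe_ne_top hA₃top)⟩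
  refine ⟨M, hMtop, fun t ht j => ?_⟩
  -- Bernstein exponent in dimension `3`
  have hexp : ((j : ℝ) * (Module.finrank ℝ (EuclideanSpace ℝ (Fin 3)) : ℝ) *
      ((2 : ℝ≥0∞).toReal⁻¹ - p.toReal⁻¹)) = (j : ℝ) * (3 * (2⁻¹ - p.toReal⁻¹)) := by
    rw [finrank_euclideanSpace_fin, ENNReal.toReal_ofNat]; push_cast; ring
  have hBern : FunctionSpaces.eLpNormDistrib p (FunctionSpaces.lpBlock j (U t)) ≤
      CB * (2 : ℝ≥0∞) ^ ((j : ℝ) * (3 * (2⁻¹ - p.toReal⁻¹))) *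
        FunctionSpaces.eLpNormDistrib 2 (FunctionSpaces.lpBlock j (U t)) := by
    have h := hCB j (U t)
    rwa [hexp] at h
  -- the slice data
  have hf : ContDiff ℝ 3 (u t) := hC3 t ht
  have hmeas : ∀ n : ℕ, n ≤ 3 → AEStronglyMeasurable (iteratedFDeriv ℝ n (u t)) volume :=
    fun n hn => (hf.continuous_iteratedFDeriv (by exact_mod_cast hn)).aestronglyMeasurable
  have hm0 : MemLp (u t) 2 volume :=
    ⟨hf.continuous.aestronglyMeasurable,
      (eLpNorm_two_le_rpow_of_lintegral_sq_le (h0 t ht)).trans_lt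
        (ENNReal.rpow_lt_top_of_nonneg (by norm_num) ENNReal.coe_ne_top)⟩
  have hm : ∀ (n : ℕ) (Cn : ℝ≥0), n ≤ 3 → ∫⁻ x, ‖iteratedFDeriv ℝ n (u t) x‖ₑ ^ 2 ≤ Cn →
      MemLp (iteratedFDeriv ℝ n (u t)) 2 volume := fun n Cn hn hbd =>
    ⟨hmeas n hn, (eLpNorm_two_le_rpow_of_lintegral_sq_le hbd).trans_lt
      (ENNReal.rpow_lt_top_of_nonneg (by norm_num) ENNReal.coe_ne_top)⟩
  have hm1 : MemLp (iteratedFDeriv ℝ 1 (u t)) 2 volume := hm 1 C₁ (by norm_num) (h1 t ht)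
  have hm2 : MemLp (iteratedFDeriv ℝ 2 (u t)) 2 volume := hm 2 C₂ (by norm_num) (h2 t ht)
  have hm3 : MemLp (iteratedFDeriv ℝ 3 (u t)) 2 volume := hm 3 C₃ le_rfl (h3 t ht)
  -- the uniform `L²` bound of the blocks
  have hL2a : FunctionSpaces.eLpNormDistrib 2 (FunctionSpaces.lpBlock j (U t)) ≤ CA * A₀ := by
    refine (hCA j (U t)).trans ?_
    gcongr
    rw [(hU t ht).eLpNormDistrib_eq hm0]
    exact eLpNorm_two_le_rpow_of_lintegral_sq_le (h0 t ht)
  -- the third-derivative bound of the blocks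
  have hthird : ∀ i k l, FunctionSpaces.eLpNormDistrib 2 (∂_{b l} (∂_{b k} (∂_{b i} (U t)))) ≤ A₃ := by
    intro i k l
    refine ((hU t ht).eLpNormDistrib_lineDeriv_three_le hf le_rfl hm0 hm1 hm2 hm3
      (b i) (b k) (b l)).trans ?_
    have hone : ‖b i‖ * ‖b k‖ * ‖b l‖ = 1 := by
      simp only [b.orthonormal.1, mul_one]
    rw [hone, ENNReal.ofReal_one, one_mul]
    exact eLpNorm_two_le_rpow_of_lintegral_sq_le (h3 t ht)
  have hL2b : FunctionSpaces.eLpNormDistrib 2 (FunctionSpaces.lpBlock j (U t)) ≤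
      K * (2 : ℝ≥0∞) ^ (-(3 * (j : ℝ))) * A₃ := hK (U t) A₃ hthird j
  have hM₁ : (CB : ℝ≥0∞) * (CA * A₀) ≤ M := le_self_add
  have hM₂ : (CB : ℝ≥0∞) * (K * A₃) ≤ M := le_add_self
  constructor
  · calc FunctionSpaces.eLpNormDistrib p (FunctionSpaces.lpBlock j (U t))
        ≤ CB * (2 : ℝ≥0∞) ^ ((j : ℝ) * (3 * (2⁻¹ - p.toReal⁻¹))) * (CA * A₀) := by
          refine hBern.trans ?_
          gcongr
      _ = CB * (CA * A₀) * (2 : ℝ≥0∞) ^ ((j : ℝ) * (3 * (2⁻¹ - p.toReal⁻¹))) := by ring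
      _ ≤ M * (2 : ℝ≥0∞) ^ ((j : ℝ) * (3 * (2⁻¹ - p.toReal⁻¹))) := by gcongr
  · calc FunctionSpaces.eLpNormDistrib p (FunctionSpaces.lpBlock j (U t))
        ≤ CB * (2 : ℝ≥0∞) ^ ((j : ℝ) * (3 * (2⁻¹ - p.toReal⁻¹))) *
            (K * (2 : ℝ≥0∞) ^ (-(3 * (j : ℝ))) * A₃) := by
          refine hBern.trans ?_
          gcongr
      _ = CB * (K * A₃) * ((2 : ℝ≥0∞) ^ ((j : ℝ) * (3 * (2⁻¹ - p.toReal⁻¹))) *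
            (2 : ℝ≥0∞) ^ (-(3 * (j : ℝ)))) := by ring
      _ ≤ M * ((2 : ℝ≥0∞) ^ ((j : ℝ) * (3 * (2⁻¹ - p.toReal⁻¹))) *
            (2 : ℝ≥0∞) ^ (-(3 * (j : ℝ)))) := by gcongr

/-- **The GKP path norm on a slab is finite.** Under the hypotheses of
`exists_blockwise_bound_of_sobolev` on `S = (0, T')`: `‖U‖_{𝓛^{1:∞}_{p,q}(0,T')} < ∞` for every
`2 ≤ p` and every `q ≥ 1` (the critical index is `s_p = -1 + 3/p`, `3/∞ = 0`): with
`σ = 3(1/2 - 1/p)` one has `s_p + σ = 1/2`, so the weights of `L̃^∞ Ḃ^{s_p}` and of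
`L̃¹ Ḃ^{s_p+2}` are dominated by `M 2^{-|j|/2}` and `M T' 2^{-|j|/2}` (`two_rpow_weight_*`), and
`eCheminLernerNorm_lt_top_of_blockwise` applies. [cite: GKP2016, Def. 1.2 and (1.5)] -/
theorem eGKPPathNorm_lt_top_of_sobolev {T' : ℝ}
    {u : ℝ → EuclideanSpace ℝ (Fin 3) → EuclideanSpace ℝ (Fin 3)}
    {U : ℝ → 𝓢'(EuclideanSpace ℝ (Fin 3), EuclideanSpace ℂ (Fin 3))}
    (hU : ∀ t ∈ Ioo 0 T', IsDistributionOf (u t) (U t)) (hC3 : ∀ t ∈ Ioo 0 T', ContDiff ℝ 3 (u t))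
    {C₀ C₁ C₂ C₃ : ℝ≥0}
    (h0 : ∀ t ∈ Ioo 0 T', ∫⁻ x, ‖u t x‖ₑ ^ 2 ≤ C₀)
    (h1 : ∀ t ∈ Ioo 0 T', ∫⁻ x, ‖iteratedFDeriv ℝ 1 (u t) x‖ₑ ^ 2 ≤ C₁)
    (h2 : ∀ t ∈ Ioo 0 T', ∫⁻ x, ‖iteratedFDeriv ℝ 2 (u t) x‖ₑ ^ 2 ≤ C₂)
    (h3 : ∀ t ∈ Ioo 0 T', ∫⁻ x, ‖iteratedFDeriv ℝ 3 (u t) x‖ₑ ^ 2 ≤ C₃)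
    (p q : ℝ≥0∞) [Fact (1 ≤ p)] (hp₂ : 2 ≤ p) (hq : 1 ≤ q) :
    FunctionSpaces.eGKPPathNorm 1 ∞ p q 0 T' U < ⊤ := by
  obtain ⟨M, hMtop, hM⟩ := exists_blockwise_bound_of_sobolev hU hC3 h0 h1 h2 h3 p hp₂
  have hSfin : volume (Ioo (0 : ℝ) T') ≠ ⊤ := by
    rw [Real.volume_Ioo]; exact ENNReal.ofReal_ne_top
  -- the critical index and the Bernstein exponent
  set σ : ℝ := 3 * (2⁻¹ - p.toReal⁻¹) with hσ
  have hcrit : FunctionSpaces.criticalIndex (EuclideanSpace ℝ (Fin 3)) p = -1 + 3 / p.toReal := by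
    rw [FunctionSpaces.criticalIndex_def, finrank_euclideanSpace_fin]; push_cast; ring
  set sp : ℝ := -1 + 3 / p.toReal with hsp
  have hsum : sp + σ = 1 / 2 := by rw [hsp, hσ, div_eq_mul_inv]; ring
  rw [FunctionSpaces.eGKPPathNorm_one_top, hcrit, max_lt_iff]
  constructor
  · -- `L̃¹((0,T'); Ḃ^{s_p+2}_{p,q})`
    refine eCheminLernerNorm_lt_top_of_blockwise measurableSet_Ioo hSfin hq hMtop fun t ht j => ?_
    rcases le_or_gt j 0 with hj | hj
    · calc (2 : ℝ≥0∞) ^ ((j : ℝ) * (sp + 2)) * FunctionSpaces.eLpNormDistrib p (FunctionSpaces.lpBlock j (U t))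
          ≤ (2 : ℝ≥0∞) ^ ((j : ℝ) * (sp + 2)) * (M * (2 : ℝ≥0∞) ^ ((j : ℝ) * σ)) := by
            gcongr; exact (hM t ht j).1
        _ = M * ((2 : ℝ≥0∞) ^ ((j : ℝ) * (sp + 2)) * (2 : ℝ≥0∞) ^ ((j : ℝ) * σ)) := by ring
        _ ≤ M * (2 : ℝ≥0∞) ^ (-(|(j : ℝ)| / 2)) := by gcongr; exact two_rpow_weight_low_two hsum hj
    · calc (2 : ℝ≥0∞) ^ ((j : ℝ) * (sp + 2)) * FunctionSpaces.eLpNormDistrib p (FunctionSpaces.lpBlock j (U t))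
          ≤ (2 : ℝ≥0∞) ^ ((j : ℝ) * (sp + 2)) *
              (M * ((2 : ℝ≥0∞) ^ ((j : ℝ) * σ) * (2 : ℝ≥0∞) ^ (-(3 * (j : ℝ))))) := by
            gcongr; exact (hM t ht j).2
        _ = M * ((2 : ℝ≥0∞) ^ ((j : ℝ) * (sp + 2)) *
              ((2 : ℝ≥0∞) ^ ((j : ℝ) * σ) * (2 : ℝ≥0∞) ^ (-(3 * (j : ℝ))))) := by ring
        _ = M * (2 : ℝ≥0∞) ^ (-(|(j : ℝ)| / 2)) := by rw [two_rpow_weight_high_two hsum hj.le]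
  · -- `L̃^∞((0,T'); Ḃ^{s_p}_{p,q})`
    refine eCheminLernerNorm_lt_top_of_blockwise measurableSet_Ioo hSfin hq hMtop fun t ht j => ?_
    rcases le_or_gt j 0 with hj | hj
    · calc (2 : ℝ≥0∞) ^ ((j : ℝ) * sp) * FunctionSpaces.eLpNormDistrib p (FunctionSpaces.lpBlock j (U t))
          ≤ (2 : ℝ≥0∞) ^ ((j : ℝ) * sp) * (M * (2 : ℝ≥0∞) ^ ((j : ℝ) * σ)) := by
            gcongr; exact (hM t ht j).1
        _ = M * ((2 : ℝ≥0∞) ^ ((j : ℝ) * sp) * (2 : ℝ≥0∞) ^ ((j : ℝ) * σ)) := by ring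
        _ = M * (2 : ℝ≥0∞) ^ (-(|(j : ℝ)| / 2)) := by rw [two_rpow_weight_low hsum hj]
    · calc (2 : ℝ≥0∞) ^ ((j : ℝ) * sp) * FunctionSpaces.eLpNormDistrib p (FunctionSpaces.lpBlock j (U t))
          ≤ (2 : ℝ≥0∞) ^ ((j : ℝ) * sp) *
              (M * ((2 : ℝ≥0∞) ^ ((j : ℝ) * σ) * (2 : ℝ≥0∞) ^ (-(3 * (j : ℝ))))) := by
            gcongr; exact (hM t ht j).2
        _ = M * ((2 : ℝ≥0∞) ^ ((j : ℝ) * sp) *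
              ((2 : ℝ≥0∞) ^ ((j : ℝ) * σ) * (2 : ℝ≥0∞) ^ (-(3 * (j : ℝ))))) := by ring
        _ ≤ M * (2 : ℝ≥0∞) ^ (-(|(j : ℝ)| / 2)) := by gcongr; exact two_rpow_weight_high hsum hj.le

end Slices

/-! ### Classical Leray–Hopf solutions lie in `𝓛^{1:∞}_{p,q}[T' < T]` -/

section Classical

/-- **Classical Leray–Hopf solutions from rapidly decaying data lie in GKP's path space**
(Gallagher–Koch–Planchon 2016, Def. 1.2, (1.5), Rem. 1.3: membership in `𝓛^{1:∞}_{p,q}[T' < T]`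
is finiteness of `‖U‖_{𝓛^{1:∞}_{p,q}(0,T')}` for each `T' < T`). Let `ν > 0`, `T > 0`, and let
`(u, π)` be a classical solution of the unforced Navier–Stokes system on `ℝ³ × [0, T)` which is
Leray–Hopf from its rapidly decaying datum, with slice distributions `U t`. Then
`MemGKPPathSpace p q T U` for every `2 ≤ p < ∞` and `q ≥ 1` — in particular for GKP's exponents
`p = q ∈ (3, ∞)`. Proof: on each closed slab `[0, T']` the solution has finite energy (Leray–Hopf)
and all Sobolev norms bounded (Tao 2013, `tao2011_hasBoundedSobolevNormsOn_holds` through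
`tao2011_hasBoundedSobolevNormsOn.closedSlab`), and `eGKPPathNorm_lt_top_of_sobolev` applies on
`(0, T')`. [cite: GKP2016, Def. 1.2 and (1.5)] -/
theorem memGKPPathSpace_of_classical {ν T : ℝ} (hν : 0 < ν) (hT : 0 < T)
    {u : ℝ → EuclideanSpace ℝ (Fin 3) → EuclideanSpace ℝ (Fin 3)}
    {π : ℝ → EuclideanSpace ℝ (Fin 3) → ℝ}
    {U : ℝ → 𝓢'(EuclideanSpace ℝ (Fin 3), EuclideanSpace ℂ (Fin 3))}
    (hsol : IsClassicalNSSolutionOn (Ico 0 T) ν 0 u π) (hLH : IsLerayHopfOn T ν 0 (u 0) u)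
    (h₀ : HasRapidSpatialDecay (u 0)) (hU : ∀ t ∈ Ico 0 T, IsDistributionOf (u t) (U t))
    (p q : ℝ≥0∞) [Fact (1 ≤ p)] (hp₂ : 2 ≤ p) (hq : 1 ≤ q) :
    MemGKPPathSpace p q T U := by
  have _ := hT
  intro T' hT'
  -- the closed slab `[0, T']`: classical, finite energy, Sobolev bounds
  have hsol' : IsClassicalNSSolutionOn (Icc 0 T') ν 0 u π :=
    hsol.mono (Icc_subset_Ico_right hT'.2) (uniqueDiffOn_Icc hT'.1)
  have hEn' : ∃ C : ℝ≥0∞, C < ⊤ ∧ ∀ t ∈ Icc 0 T', ∫⁻ x, ‖u t x‖ₑ ^ 2 ≤ C :=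
    ⟨ENNReal.ofReal (2 * VectorCalculus.kineticEnergy (u 0)), ENNReal.ofReal_lt_top, fun t ht =>
      hLH.lintegral_enorm_sq_le hν.le ⟨ht.1, ht.2.trans hT'.2.le⟩⟩
  have hH : HasBoundedSobolevNormsOn (Icc 0 T') u :=
    (tao2011_hasBoundedSobolevNormsOn.closedSlab tao2011_hasBoundedSobolevNormsOn_holds
      linfty_bound_of_hasBoundedSobolevNormsOn_holds ν T' hν hT'.1 u π hsol' hEn' h₀).1
  obtain ⟨C₀, hC₀⟩ := hH 0
  obtain ⟨C₁, hC₁⟩ := hH 1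
  obtain ⟨C₂, hC₂⟩ := hH 2
  obtain ⟨C₃, hC₃⟩ := hH 3
  have hsub : Ioo 0 T' ⊆ Icc 0 T' := Ioo_subset_Icc_self
  have h0 : ∀ t ∈ Ioo 0 T', ∫⁻ x, ‖u t x‖ₑ ^ 2 ≤ C₀ := fun t ht => by
    refine le_of_eq_of_le (lintegral_congr fun x => ?_) (hC₀ t (hsub ht))
    rw [← ofReal_norm, ← ofReal_norm, norm_iteratedFDeriv_zero]
  exact eGKPPathNorm_lt_top_of_sobolev (fun t ht => hU t ⟨ht.1.le, ht.2.trans hT'.2⟩)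
    (fun t ht => (hsol'.contDiff_velocity (hsub ht)).of_le (by norm_cast))
    h0 (fun t ht => hC₁ t (hsub ht)) (fun t ht => hC₂ t (hsub ht)) (fun t ht => hC₃ t (hsub ht))
    p q hp₂ hq

end Classical

end Literature.Analysis.FluidPDE

end
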